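import Mathlib
import Literature.Computability.AlgebraicComplexity.PermanentIrreducible
import Summits.ValiantsHypothesis.ValiantsHypothesis.Theorems.RigidityForcesSymmetryRankRigidMinimalReprLaplaceFourOptimal

/-!
# The Laplace-weight inequality for identities `per₄ = Σᵢ pᵢ qᵢ` (what `LaplaceOptimal 4` says about `str₂(per₄)`)
# (support item `StrengthTwoPerFour`, stmt-ValiantsHypothesis-25160, route `PolyaContinued` — helper, necessary condition)

The item `StrengthTwoPerFour` («str₂(per₄) = 6») says that the `4 × 4` permanent is not a sum of FIVE products
`pᵢ qᵢ` of quadrics.  This file records, in the kernel, exactly what the tensor theorem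
`laplaceOptimal_four : LaplaceOptimal 4` (`…RigidityForcesSymmetryRankRigidMinimalReprLaplaceFourOptimal.lean`:
every split-rank-one decomposition of the permutation pattern `P₄(v) = [v injective]` has Laplace weight
`Σ_t |S_t|! (4 - |S_t|)! ≥ 24`) says about such identities.  The companion file
`…PolyaContinuedStrengthTwoPerFourRowSplit.lean` draws the special cases (row-split and column-split strata, the
numerical instrument I3's «System B» of the cell `val-width`, now a theorem).

NOTATION (inlined, no definitions).  For `v : Fin 4 → Fin 4` and a set of rows `R ⊆ Fin 4` the ROW-GRAPH exponent
is `g_R(v) = Σ_{j ∈ R} e_{(j, v j)}` (the monomial `Π_{j∈R} x_{j, v(j)}`); `g(v) = g_{Fin 4}(v)` is the graph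
exponent, whose coefficient in `per₄` is `[v injective]` (`coeff_graph_perPoly`, folklore; the same lemma is
`ForgivenCollisionsOrderedLaw.coeff_graph_perPoly`, re-proved here to keep this file independent of that route).
The pair `(pᵢ, qᵢ)` is ACTIVE on `R` if `pᵢ` has a monomial of shape `g_R(v)` and `qᵢ` one of shape `g_{Rᶜ}(v')`.

MAIN THEOREM (`laplaceWeight_le_of_perPoly_eq_sum`).  Let `per₄ = Σ_{i<N} pᵢ qᵢ` with ARBITRARY polynomials
`pᵢ, qᵢ`, and let `A i ⊇ {R : (pᵢ, qᵢ) active on R}`.  Then `Σᵢ Σ_{R ∈ A i} |R|!(4-|R|)! ≥ 24`.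
PROOF.  The divisors of `g(v)` are exactly the pairs `(g_R(v), g_{Rᶜ}(v))` (`eq_rowGraph_of_add_eq_graph`), so
`coeff_{g(v)}(pᵢqᵢ) = Σ_R coeff_{pᵢ}(g_R v) · coeff_{qᵢ}(g_{Rᶜ} v)` (`coeff_graph_mul`); the term `(i, R)` is a
split-rank-one term with dependence set `R`, inactive terms vanish, and summing over `i` gives a decomposition of
`P₄`, whose weight `laplaceOptimal_four` bounds.

COROLLARY (`exists_two_active_rowSets`).  If the `pᵢ` are QUADRICS (homogeneous of degree `2` — the item's
setting; the `qᵢ` arbitrary) and `per₄ = Σ_{i<N} pᵢqᵢ` with `N < 6`, then SOME PRODUCT STRADDLES TWO ROW SPLITS: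
there are `i` and row sets `R ≠ R'` with `(pᵢ, qᵢ)` active on both (for a quadric only `|R| = 2` can be active,
weight `4` each, so `Σᵢ nᵢ ≥ 6` active pairs are needed, `nᵢ` = number of active row pairs of the `i`-th product;
with `N ≤ 5` some `nᵢ ≥ 2`).  Equivalently: no identity of width `≤ 5` is assembled from products that are pure
in the row grading — the first exact, kernel-level constraint on the shape of a hypothetical width-five identity.

HONEST FRAMING.  A NECESSARY CONDITION for a counter-example to stmt-25160 (filed `--supports`; the item is not
closed and not claimed): a general quadric `pᵢ` is active on several row pairs, and the cancellation of the
non-multilinear part of `Σ pᵢqᵢ` is invisible to this argument — that freedom is exactly what separates the item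
from `LaplaceOptimal 4` (honest `6` / border `5` there: `laplaceOptimal_four` / `laplaceOptimal_four_border`).
`StrengthTwoPerFour` stays OPEN/GATED (`4 ≤ str₂(per₄) ≤ 6`, border `≤ 5`); nothing here bears on `VP ≠ VNP`.
-/

set_option autoImplicit false

-- the mandated summit-side namespace repeats a component by design (single-problem summit)
set_option linter.dupNamespace false

namespace Summit.ValiantsHypothesis.ValiantsHypothesis.Theorems.PolyaContinuedLaplaceRigidity.RowWeight

open MvPolynomial Literature.Computability.AlgebraicComplexity
open Summit.ValiantsHypothesis.ValiantsHypothesis.Theorems.RigidityForcesSymmetryRankRigidMinimalRepr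
  (LaplaceOptimal laplaceOptimal_four)

/-! ### §1 Row-graph exponents -/

/-- The row-graph exponent `g_R(v) = Σ_{j∈R} e_{(j, v j)}` takes the value `[ρ ∈ R ∧ v ρ = c]` at the cell
`(ρ, c)`. -/
theorem rowGraph_apply (R : Finset (Fin 4)) (v : Fin 4 → Fin 4) (ρ c : Fin 4) :
    (∑ j ∈ R, Finsupp.single (j, v j) (1 : ℕ)) (ρ, c) = if ρ ∈ R ∧ v ρ = c then 1 else 0 := by
  rw [Finsupp.finsetSum_apply]
  have hterm : ∀ j ∈ R, (Finsupp.single (j, v j) (1 : ℕ)) (ρ, c) =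
      if ρ = j then (if v ρ = c then 1 else 0) else 0 := by
    intro j _
    rw [Finsupp.single_apply]
    by_cases hj : ρ = j
    · subst hj
      by_cases hc : v ρ = c
      · simp [hc]
      · have : ¬ ((ρ, v ρ) = (ρ, c)) := fun h => hc (Prod.mk.inj h).2
        simp [hc]
    · have : ¬ ((j, v j) = (ρ, c)) := fun h => hj (Prod.mk.inj h).1.symm
      simp [this, hj]
  rw [Finset.sum_congr rfl hterm, Finset.sum_ite_eq]
  by_cases hρ : ρ ∈ R
  · simp [hρ]
  · simp [hρ]

/-- The graph exponent `g(v) = Σ_j e_{(j, v j)}` takes the value `[v ρ = c]` at the cell `(ρ, c)`. [folklore] -/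
theorem graph_apply (v : Fin 4 → Fin 4) (ρ c : Fin 4) :
    (∑ j, Finsupp.single (j, v j) (1 : ℕ)) (ρ, c) = if v ρ = c then 1 else 0 := by
  have h := rowGraph_apply Finset.univ v ρ c
  simpa using h

/-- The coefficient of the graph monomial `Π_j x_{j, v j}` in `per₄` is `[v injective]`. [folklore]
(Same statement as `ForgivenCollisionsOrderedLaw.coeff_graph_perPoly`; re-proved from `PermanentIrreducible`.) -/
theorem coeff_graph_perPoly (v : Fin 4 → Fin 4) :
    coeff (∑ j, Finsupp.single (j, v j) (1 : ℕ)) (perPoly (Fin 4) ℂ) =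
      if Function.Injective v then 1 else 0 := by
  split_ifs with hv
  · have hb : Function.Bijective v := Finite.injective_iff_bijective.1 hv
    have key : permMonomial (Equiv.ofBijective v hb).symm = ∑ j, Finsupp.single (j, v j) (1 : ℕ) := by
      ext ⟨r, c⟩
      rw [permMonomial_apply, graph_apply]
      have : ((Equiv.ofBijective v hb).symm c = r) ↔ (v r = c) := by
        rw [Equiv.symm_apply_eq, Equiv.ofBijective_apply]
        exact eq_comm
      simp only [this]
    rw [← key, coeff_permMonomial_perPoly]
  · by_contra hne
    obtain ⟨ρ, hρ⟩ := exists_permMonomial_eq_of_coeff_perPoly_ne_zero ℂ hne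
    apply hv
    have hleft : ∀ r, ρ (v r) = r := fun r => by
      have h := DFunLike.congr_fun hρ (r, v r)
      rw [permMonomial_apply, graph_apply, if_pos rfl] at h
      by_contra h'
      rw [if_neg h'] at h
      exact zero_ne_one h
    intro r r' hrr'
    rw [← hleft r, ← hleft r', hrr']

/-- `g_R(v)` depends only on `v|_R`. -/
theorem rowGraph_congr (R : Finset (Fin 4)) {v v' : Fin 4 → Fin 4} (h : ∀ j ∈ R, v j = v' j) :
    (∑ j ∈ R, Finsupp.single (j, v j) (1 : ℕ)) = ∑ j ∈ R, Finsupp.single (j, v' j) (1 : ℕ) :=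
  Finset.sum_congr rfl fun j hj => by rw [h j hj]

/-- The degree of `g_R(v)` is `|R|`. -/
theorem degree_rowGraph (R : Finset (Fin 4)) (v : Fin 4 → Fin 4) :
    (∑ j ∈ R, Finsupp.single (j, v j) (1 : ℕ)).degree = R.card := by
  rw [map_sum]
  simp [Finsupp.degree_single]

/-- `g_R(v) + g_{Rᶜ}(v) = g(v)`. -/
theorem rowGraph_add_rowGraph_compl (R : Finset (Fin 4)) (v : Fin 4 → Fin 4) :
    (∑ j ∈ R, Finsupp.single (j, v j) (1 : ℕ)) + ∑ j ∈ Rᶜ, Finsupp.single (j, v j) (1 : ℕ) =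
      ∑ j, Finsupp.single (j, v j) (1 : ℕ) :=
  Finset.sum_add_sum_compl R _

/-- The row set read off from `g_R(v)` is `R`. -/
theorem filter_rowGraph_ne_zero (R : Finset (Fin 4)) (v : Fin 4 → Fin 4) :
    Finset.univ.filter (fun j => (∑ k ∈ R, Finsupp.single (k, v k) (1 : ℕ)) (j, v j) ≠ 0) = R := by
  ext j
  simp [rowGraph_apply]

/-- **Divisors of a graph exponent.**  If `d₁ + d₂ = g(v)` then `d₁ = g_R(v)` and `d₂ = g_{Rᶜ}(v)` for the row
set `R = {j : d₁(j, v j) ≠ 0}`. -/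
theorem eq_rowGraph_of_add_eq_graph (v : Fin 4 → Fin 4) (d₁ d₂ : (Fin 4 × Fin 4) →₀ ℕ)
    (h : d₁ + d₂ = ∑ j, Finsupp.single (j, v j) (1 : ℕ)) :
    d₁ = ∑ j ∈ Finset.univ.filter (fun j => d₁ (j, v j) ≠ 0), Finsupp.single (j, v j) (1 : ℕ) ∧
    d₂ = ∑ j ∈ (Finset.univ.filter (fun j => d₁ (j, v j) ≠ 0))ᶜ, Finsupp.single (j, v j) (1 : ℕ) := by
  have hcell : ∀ ρ c : Fin 4, d₁ (ρ, c) + d₂ (ρ, c) = if v ρ = c then 1 else 0 := by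
    intro ρ c
    have := DFunLike.congr_fun h (ρ, c)
    rwa [Finsupp.add_apply, graph_apply] at this
  constructor
  · ext ⟨ρ, c⟩
    rw [rowGraph_apply]
    simp only [Finset.mem_filter, Finset.mem_univ, true_and]
    have hρc := hcell ρ c
    by_cases hv : v ρ = c
    · subst hv
      rw [if_pos rfl] at hρc
      by_cases hz : d₁ (ρ, v ρ) = 0
      · simp [hz]
      · rw [if_pos ⟨hz, rfl⟩]; omega
    · rw [if_neg hv] at hρc
      rw [if_neg (fun h' => hv h'.2)]; omega
  · ext ⟨ρ, c⟩
    rw [rowGraph_apply]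
    simp only [Finset.mem_compl, Finset.mem_filter, Finset.mem_univ, true_and, not_not]
    have hρc := hcell ρ c
    by_cases hv : v ρ = c
    · subst hv
      rw [if_pos rfl] at hρc
      by_cases hz : d₁ (ρ, v ρ) = 0
      · rw [if_pos ⟨hz, rfl⟩]; omega
      · rw [if_neg (fun h' => hz h'.1)]; omega
    · rw [if_neg hv] at hρc
      rw [if_neg (fun h' => hv h'.2)]; omega

/-- **Coefficient of a graph monomial in a product.**  For ANY polynomials `p, q`:
`coeff_{g(v)}(p q) = Σ_{R ⊆ Fin 4} coeff_p(g_R v) · coeff_q(g_{Rᶜ} v)`. -/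
theorem coeff_graph_mul (p q : MvPolynomial (Fin 4 × Fin 4) ℂ) (v : Fin 4 → Fin 4) :
    coeff (∑ j, Finsupp.single (j, v j) (1 : ℕ)) (p * q) =
      ∑ R : Finset (Fin 4), coeff (∑ j ∈ R, Finsupp.single (j, v j) (1 : ℕ)) p *
        coeff (∑ j ∈ Rᶜ, Finsupp.single (j, v j) (1 : ℕ)) q := by
  classical
  rw [coeff_mul]
  refine Finset.sum_nbij' (fun x => Finset.univ.filter (fun j => x.1 (j, v j) ≠ 0))
    (fun R => (∑ j ∈ R, Finsupp.single (j, v j) (1 : ℕ), ∑ j ∈ Rᶜ, Finsupp.single (j, v j) (1 : ℕ)))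
    (fun _ _ => Finset.mem_univ _) ?_ ?_ ?_ ?_
  · intro R _
    exact Finset.HasAntidiagonal.mem_antidiagonal.2 (rowGraph_add_rowGraph_compl R v)
  · rintro ⟨d₁, d₂⟩ hx
    obtain ⟨h1, h2⟩ := eq_rowGraph_of_add_eq_graph v d₁ d₂ (Finset.HasAntidiagonal.mem_antidiagonal.1 hx)
    exact Prod.ext h1.symm h2.symm
  · intro R _
    exact filter_rowGraph_ne_zero R v
  · rintro ⟨d₁, d₂⟩ hx
    obtain ⟨h1, h2⟩ := eq_rowGraph_of_add_eq_graph v d₁ d₂ (Finset.HasAntidiagonal.mem_antidiagonal.1 hx)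
    dsimp only
    rw [← h1, ← h2]

/-! ### §2 The Laplace-weight inequality -/

/-- Transport of a sum over the encoded index set `T ⊆ Fin M` back to `Σᵢ Σ_{R ∈ A i}`. -/
theorem sum_encode (N : ℕ) (A : Fin N → Finset (Finset (Fin 4))) {M : Type*} [AddCommMonoid M]
    (e : (Fin N × Finset (Fin 4)) ≃ Fin (Fintype.card (Fin N × Finset (Fin 4))))
    (f : Fin N × Finset (Fin 4) → M) :
    (∑ t ∈ (Finset.univ.filter (fun x : Fin N × Finset (Fin 4) => x.2 ∈ A x.1)).map e.toEmbedding,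
        f (e.symm t)) = ∑ i, ∑ R ∈ A i, f (i, R) := by
  classical
  rw [Finset.sum_map]
  simp only [Equiv.coe_toEmbedding, Equiv.symm_apply_apply]
  rw [Finset.sum_filter, Fintype.sum_prod_type]
  refine Finset.sum_congr rfl fun i _ => ?_
  rw [← Finset.sum_filter]
  congr 1
  ext R
  simp

/-- **MAIN THEOREM — the Laplace-weight inequality for `per₄ = Σᵢ pᵢ qᵢ`.**  For arbitrary polynomials `pᵢ, qᵢ`
with `per₄ = Σ_{i<N} pᵢ qᵢ` and any families `A i` of row sets off which the pair `(pᵢ, qᵢ)` is inactive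
(`R ∉ A i ⇒` `pᵢ` has no `g_R`-shaped monomial or `qᵢ` has no `g_{Rᶜ}`-shaped monomial):
`24 ≤ Σᵢ Σ_{R ∈ A i} |R|! (4 - |R|)!`.  Corollary of `laplaceOptimal_four`. -/
theorem laplaceWeight_le_of_perPoly_eq_sum (N : ℕ) (p q : Fin N → MvPolynomial (Fin 4 × Fin 4) ℂ)
    (A : Fin N → Finset (Finset (Fin 4)))
    (hA : ∀ i, ∀ R : Finset (Fin 4), R ∉ A i →
      (∀ v : Fin 4 → Fin 4, coeff (∑ j ∈ R, Finsupp.single (j, v j) (1 : ℕ)) (p i) = 0) ∨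
      (∀ v : Fin 4 → Fin 4, coeff (∑ j ∈ Rᶜ, Finsupp.single (j, v j) (1 : ℕ)) (q i) = 0))
    (hper : perPoly (Fin 4) ℂ = ∑ i, p i * q i) :
    24 ≤ ∑ i, ∑ R ∈ A i, R.card.factorial * (4 - R.card).factorial := by
  classical
  -- per-product coefficient of the graph monomial, restricted to the active row sets
  have hcoeff : ∀ i (v : Fin 4 → Fin 4), coeff (∑ j, Finsupp.single (j, v j) (1 : ℕ)) (p i * q i) =
      ∑ R ∈ A i, coeff (∑ j ∈ R, Finsupp.single (j, v j) (1 : ℕ)) (p i) *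
        coeff (∑ j ∈ Rᶜ, Finsupp.single (j, v j) (1 : ℕ)) (q i) := by
    intro i v
    rw [coeff_graph_mul]
    symm
    refine Finset.sum_subset (Finset.subset_univ _) fun R _ hR => ?_
    rcases hA i R hR with h0 | h0
    · rw [h0 v, zero_mul]
    · rw [h0 v, mul_zero]
  -- encode the index pairs `(i, R)` into `Fin M`
  let e := Fintype.equivFin (Fin N × Finset (Fin 4))
  let T : Finset (Fin (Fintype.card (Fin N × Finset (Fin 4)))) :=
    (Finset.univ.filter (fun x : Fin N × Finset (Fin 4) => x.2 ∈ A x.1)).map e.toEmbedding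
  let S : Fin (Fintype.card (Fin N × Finset (Fin 4))) → Finset (Fin 4) := fun t => (e.symm t).2
  let u : Fin (Fintype.card (Fin N × Finset (Fin 4))) → (Fin 4 → Fin 4) → ℂ := fun t v =>
    coeff (∑ j ∈ (e.symm t).2, Finsupp.single (j, v j) (1 : ℕ)) (p (e.symm t).1)
  let w : Fin (Fintype.card (Fin N × Finset (Fin 4))) → (Fin 4 → Fin 4) → ℂ := fun t v =>
    coeff (∑ j ∈ (e.symm t).2ᶜ, Finsupp.single (j, v j) (1 : ℕ)) (q (e.symm t).1)
  have hu : ∀ t, ∀ v v' : Fin 4 → Fin 4, (∀ j ∈ S t, v j = v' j) → u t v = u t v' := by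
    intro t v v' hvv'
    have h' : ∀ j ∈ (e.symm t).2, v j = v' j := hvv'
    simp only [u, rowGraph_congr _ h']
  have hw : ∀ t, ∀ v v' : Fin 4 → Fin 4, (∀ j, j ∉ S t → v j = v' j) → w t v = w t v' := by
    intro t v v' hvv'
    have h' : ∀ j ∈ (S t)ᶜ, v j = v' j := fun j hj => hvv' j (Finset.mem_compl.1 hj)
    simp only [w, S, rowGraph_congr _ h']
  have hsum : ∀ v : Fin 4 → Fin 4, (∑ t ∈ T, u t v * w t v) = if Function.Injective v then 1 else 0 := by
    intro v
    rw [← coeff_graph_perPoly v, hper, coeff_sum]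
    have := sum_encode N A e (fun x => coeff (∑ j ∈ x.2, Finsupp.single (j, v j) (1 : ℕ)) (p x.1) *
      coeff (∑ j ∈ x.2ᶜ, Finsupp.single (j, v j) (1 : ℕ)) (q x.1))
    simp only [u, w, T]
    rw [this]
    exact Finset.sum_congr rfl fun i _ => (hcoeff i v).symm
  have hbound := laplaceOptimal_four _ T S u w hu hw hsum
  have hweight := sum_encode N A e (fun x => x.2.card.factorial * (4 - x.2.card).factorial)
  simp only [S, T] at hbound hweight
  rw [hweight] at hbound
  exact hbound

/-- Contrapositive form: families `A i` of total weight `< 24` off which the pairs `(pᵢ, qᵢ)` are inactive rule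
out the identity `per₄ = Σ_{i<N} pᵢ qᵢ`. -/
theorem perPoly_ne_sum_of_weight_lt (N : ℕ) (p q : Fin N → MvPolynomial (Fin 4 × Fin 4) ℂ)
    (A : Fin N → Finset (Finset (Fin 4)))
    (hA : ∀ i, ∀ R : Finset (Fin 4), R ∉ A i →
      (∀ v : Fin 4 → Fin 4, coeff (∑ j ∈ R, Finsupp.single (j, v j) (1 : ℕ)) (p i) = 0) ∨
      (∀ v : Fin 4 → Fin 4, coeff (∑ j ∈ Rᶜ, Finsupp.single (j, v j) (1 : ℕ)) (q i) = 0))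
    (hw : ∑ i, ∑ R ∈ A i, R.card.factorial * (4 - R.card).factorial < 24) :
    perPoly (Fin 4) ℂ ≠ ∑ i, p i * q i :=
  fun hper => absurd (laplaceWeight_le_of_perPoly_eq_sum N p q A hA hper) (not_le.2 hw)

/-! ### §3 Quadrics: some product straddles two row splits -/

/-- For a QUADRIC `p` (homogeneous of degree `2`) only row PAIRS can be active: `coeff_p(g_R v) ≠ 0 ⇒ |R| = 2`. -/
theorem card_eq_two_of_coeff_rowGraph_ne_zero {p : MvPolynomial (Fin 4 × Fin 4) ℂ} (hp : p.IsHomogeneous 2)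
    {R : Finset (Fin 4)} {v : Fin 4 → Fin 4}
    (h : coeff (∑ j ∈ R, Finsupp.single (j, v j) (1 : ℕ)) p ≠ 0) : R.card = 2 := by
  by_contra hne
  exact h (hp.coeff_eq_zero (by rw [degree_rowGraph]; exact hne))

/-- **Some product straddles two row splits.**  If the `pᵢ` (`i < N`, `N < 6`) are QUADRICS (homogeneous of
degree `2`; the `qᵢ` are arbitrary) and `per₄ = Σᵢ pᵢ qᵢ`, then for some `i` there are two DIFFERENT row sets
`R ≠ R'` such that `pᵢ` has monomials of both shapes `g_R`, `g_{R'}` and `qᵢ` has monomials of both shapes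
`g_{Rᶜ}`, `g_{R'ᶜ}` (necessarily `|R| = |R'| = 2`).  In words: the multilinear part of some `pᵢ qᵢ` meets `P₄`
across at least two of the six `2 | 2` row splits — a width-`≤ 5` identity cannot be assembled from products that
are pure in the row grading. -/
theorem exists_two_active_rowSets (N : ℕ) (hN : N < 6) (p q : Fin N → MvPolynomial (Fin 4 × Fin 4) ℂ)
    (hp : ∀ i, (p i).IsHomogeneous 2)
    (hper : perPoly (Fin 4) ℂ = ∑ i, p i * q i) :
    ∃ i, ∃ R R' : Finset (Fin 4), R ≠ R' ∧
      (∃ v : Fin 4 → Fin 4, coeff (∑ j ∈ R, Finsupp.single (j, v j) (1 : ℕ)) (p i) ≠ 0) ∧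
      (∃ v : Fin 4 → Fin 4, coeff (∑ j ∈ Rᶜ, Finsupp.single (j, v j) (1 : ℕ)) (q i) ≠ 0) ∧
      (∃ v : Fin 4 → Fin 4, coeff (∑ j ∈ R', Finsupp.single (j, v j) (1 : ℕ)) (p i) ≠ 0) ∧
      (∃ v : Fin 4 → Fin 4, coeff (∑ j ∈ R'ᶜ, Finsupp.single (j, v j) (1 : ℕ)) (q i) ≠ 0) := by
  classical
  by_contra hnone
  push Not at hnone
  -- the active row sets of the pair `(pᵢ, qᵢ)`
  let A : Fin N → Finset (Finset (Fin 4)) := fun i => Finset.univ.filter fun R =>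
    (∃ v : Fin 4 → Fin 4, coeff (∑ j ∈ R, Finsupp.single (j, v j) (1 : ℕ)) (p i) ≠ 0) ∧
    (∃ v : Fin 4 → Fin 4, coeff (∑ j ∈ Rᶜ, Finsupp.single (j, v j) (1 : ℕ)) (q i) ≠ 0)
  have hA : ∀ i, ∀ R : Finset (Fin 4), R ∉ A i →
      (∀ v : Fin 4 → Fin 4, coeff (∑ j ∈ R, Finsupp.single (j, v j) (1 : ℕ)) (p i) = 0) ∨
      (∀ v : Fin 4 → Fin 4, coeff (∑ j ∈ Rᶜ, Finsupp.single (j, v j) (1 : ℕ)) (q i) = 0) := by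
    intro i R hR
    simp only [A, Finset.mem_filter, Finset.mem_univ, true_and, not_and_or, not_exists, not_not] at hR
    exact hR
  -- at most one active row set per `i`, each of weight `4`
  have hcard : ∀ i, (A i).card ≤ 1 := by
    intro i
    rw [Finset.card_le_one]
    intro R hR R' hR'
    simp only [A, Finset.mem_filter, Finset.mem_univ, true_and] at hR hR'
    by_contra hRR'
    obtain ⟨v₄, hv₄⟩ := hR'.2
    exact hv₄ (hnone i R R' hRR' hR.1 hR.2 hR'.1 v₄)
  have hwt : ∀ i, ∀ R ∈ A i, R.card.factorial * (4 - R.card).factorial = 4 := by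
    intro i R hR
    simp only [A, Finset.mem_filter, Finset.mem_univ, true_and] at hR
    obtain ⟨⟨v, hv⟩, -⟩ := hR
    rw [card_eq_two_of_coeff_rowGraph_ne_zero (hp i) hv]
    decide
  have hle : ∑ i, ∑ R ∈ A i, R.card.factorial * (4 - R.card).factorial ≤ ∑ _i : Fin N, 4 := by
    refine Finset.sum_le_sum fun i _ => ?_
    rw [Finset.sum_congr rfl (hwt i), Finset.sum_const, smul_eq_mul]
    have := hcard i
    omega
  have h24 := laplaceWeight_le_of_perPoly_eq_sum N p q A hA hper
  rw [Finset.sum_const, Finset.card_univ, Fintype.card_fin, smul_eq_mul] at hle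
  omega

end Summit.ValiantsHypothesis.ValiantsHypothesis.Theorems.PolyaContinuedLaplaceRigidity.RowWeight
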